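import Summits.AnomalousDissipation.AnomalousDissipation.Theorems.MomentParityGalerkinInvariantLoudStubKrylovBogoliubovTested
import Summits.AnomalousDissipation.AnomalousDissipation.Theorems.MomentParityGalerkinInvariantLoudStubUpperSemicontinuity
import Literature.Analysis.FluidPDE.StatisticalSolutions

/-!
# Line `conley-continuation-loud-saddles` (crux stmt-AnomalousDissipation-14283, `MomentParity.GalerkinInvariantLoud`):
# the load-bearing stub implies the ENSEMBLE ZEROTH LAW (certified lower bound on its difficulty)

The line's one open stub `stub_indexedLoudShadows` (skeleton
`Cruxes/GalerkinInvariantLoud/Lines/conley_continuation_loud_saddles.lean`, lead's reshape r2) posits, for some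
smooth solenoidal mean-zero force `f`, viscosities `ν_j → 0⁺` and a `j`-UNIFORM window `(E, ε)`, at every `j` a
norm-compact LOUD CARRIER `K_j ⊆ H = L²_σ(T³)` (every probability law carried by `K_j` satisfying the
Foias–Prodi generator identity for every cylindrical test has energy `< E` and dissipation `> ε`) together with
GALERKIN SHADOWS (nonempty closed level-`N` sets, forward-invariant for the tested Galerkin dynamics, for all
large `N`, accumulating on `K_j` in norm).

This file proves, sorry-free, that any such datum yields — at EVERY `j` — a stationary statistical solution
of the Navier–Stokes equations at `(ν_j, f)` in the tree's sense (`Torus.IsStationaryStatisticalSolution`: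
finite mean enstrophy, Liouville identity for every cylindrical test, shell energy inequalities), carried by
`K_j`, with energy `< E` and dissipation `> ε` (`exists_loudSSS_of_shadows`), hence the one-force ensemble
zeroth law `EnsembleZerothLawAt f` (`ensembleZerothLaw_of_indexedLoudShadows`; the conclusion is verbatim the
body of route Ensemble's open crux `Theses.Ensemble.EnsembleZerothLawSomeForce`, stmt-AnomalousDissipation-0214,
"the zeroth law in measure form").

So the stub is AT LEAST the ensemble zeroth law for some force: a kernel-checked reason why it is crux-sized
(the lead's `promote-stub` evidence), complementing the kernel-checked composition `stub ⇒ GalerkinInvariantLoud`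
of the skeleton. Ingredients, all landed: Krylov–Bogoliubov + Liouville for tested paths
(`KrylovBogoliubovTested.stub_krylovBogoliubov`, p148750), the energy-row enstrophy budget and the support lemma of
the upper-semicontinuity stub (`UpperSemicontinuity.ensembleEnstrophy_le_energyRowBudget`,
`measure_compl_eq_zero_of_lsc`, p149730), Rellich–Prokhorov extraction
(`MomentParityResolvedDissipation.TightExtraction.stub_tightExtraction`) and "Galerkin limits of admissible laws
are stationary statistical solutions" (`MomentParityResolvedDissipation.LimitSSS.stub_limitIsStationarySolution`).

References: Foias–Manley–Rosa–Temam, *Navier–Stokes Equations and Turbulence* (CUP 2001), Ch. IV §1 Def. 1.3,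
§3 (time-average measures), Ch. V §1; Frisch, *Turbulence* (CUP 1995), §5.2 (the zeroth law as hypothesis).
-/

set_option linter.dupNamespace false

noncomputable section

namespace Summit.AnomalousDissipation.AnomalousDissipation.Theorems.GalerkinInvariantLoud.ConleyShadows

open MeasureTheory Filter Topology Set Metric
open scoped ENNReal
open Literature.Analysis.FunctionSpaces Literature.Analysis.FluidPDE
open Summit.AnomalousDissipation.AnomalousDissipation.Theses.MomentParity
open Summit.AnomalousDissipation.AnomalousDissipation.Theorems
open Summit.AnomalousDissipation.AnomalousDissipation.Theorems.CubicParityLoud.Negative (T3 R3 H3)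
open Summit.AnomalousDissipation.AnomalousDissipation.Theorems.QuarticGate.Negative
  (IsLevel IsBandTest polyGrad IsPolyStationary kolField kolState isLevel_kolState nsGeneratorPairing_kolField
   coe_kolState_ae ensembleEnergy_dirac_kolState ensembleDissipation_dirac_kolState)
open Summit.AnomalousDissipation.AnomalousDissipation.Theorems.GalerkinInvariantLoud.Negative
  (IsInvariant isInvariant_iff_forall integrable_norm_pow_of_ae_le)

/-- **Loud compact carriers with Galerkin shadows carry loud stationary statistical solutions** (fixed
`ν > 0`, `f` smooth). Let `K` be norm-compact with the loud window, shadowed by eventually nonempty closed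
level-`N` sets `Ks N`, forward-invariant for the tested Galerkin dynamics, accumulating on `K` in norm. Then
some stationary statistical solution of NS at `(ν, f)` is carried by `K` (so it has energy `< E` and
dissipation `> ε`) and has finite second moment.
Proof: eventually `Ks N ⊆ B̄_R`; at each large level pick a point of the shadow, its tested path and (for a
fixed generalized limit) its Krylov–Bogoliubov law — invariant, carried by the closed shadow, hence admissible
(level `N`, ball `R`, all degrees) with the `N`-uniform enstrophy budget of the energy row; extract a limit law
(Rellich–Prokhorov), which is a stationary statistical solution (`stub_limitIsStationarySolution`) carried by
`K` (lsc portmanteau on the complements of the closed thickenings of `K`); apply the window. [folklore] -/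
theorem exists_loudSSS_of_shadows {ν : ℝ} {f : T3 → R3} {E ε : ℝ} (hν : 0 < ν) (hfs : Torus.IsSmooth f)
    {K : Set H3} {Ks : ℕ → Set H3} (hKc : IsCompact K)
    (hwin : ∀ μ : Measure H3, IsProbabilityMeasure μ → μ Kᶜ = 0 →
      (∀ Φ : Torus.CylindricalTest (Fin 3),
        Integrable (fun u => Torus.nsGeneratorPairing ν f u (Φ.grad u)) μ ∧
          ∫ u, Torus.nsGeneratorPairing ν f u (Φ.grad u) ∂μ = 0) →
      Torus.ensembleEnergy μ < E ∧ ε < Torus.ensembleDissipation ν μ)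
    (hshadow : ∀ᶠ N in atTop, (Ks N).Nonempty ∧ IsClosed (Ks N) ∧ (∀ a ∈ Ks N, IsLevel N a) ∧
      ∀ a ∈ Ks N, ∃ U : ℝ → H3, ContinuousOn U (Ici 0) ∧ U 0 = a ∧ (∀ t, 0 ≤ t → U t ∈ Ks N) ∧
        ∀ b : T3 → R3, IsBandTest N b → ∀ s t : ℝ, 0 ≤ s → s ≤ t →
          Torus.pairing (U t).1 b - Torus.pairing (U s).1 b =
            ∫ τ in s..t, Torus.nsGeneratorPairing ν f (U τ) b)
    (hacc : ∀ η : ℝ, 0 < η → ∀ᶠ N in atTop, ∀ a ∈ Ks N, ∃ b ∈ K, ‖a - b‖ < η) :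
    ∃ μ : Measure H3, Torus.IsStationaryStatisticalSolution ν f μ ∧
      Integrable (fun u : H3 => ‖u‖ ^ 2) μ ∧ μ Kᶜ = 0 ∧
      Torus.ensembleEnergy μ < E ∧ ε < Torus.ensembleDissipation ν μ := by
  have hf : MemLp f 2 volume := hfs.memLp 2
  -- the radius: `K` is bounded and the shadows are eventually within distance `1` of `K`
  obtain ⟨R₀, hR₀⟩ := hKc.isBounded.subset_closedBall (0 : H3)
  set R : ℝ := max R₀ 0 + 1 with hR_def
  have hR : 0 ≤ R := by positivity
  have hnear : ∀ᶠ N in atTop, ∀ a ∈ Ks N, ‖a‖ ≤ R := by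
    filter_upwards [hacc 1 one_pos] with N hN a ha
    obtain ⟨b, hb, hab⟩ := hN a ha
    have hb' : ‖b‖ ≤ R₀ := mem_closedBall_zero_iff.1 (hR₀ hb)
    have hsub : ‖a‖ - ‖b‖ ≤ ‖a - b‖ := norm_sub_norm_le a b
    have hmax : R₀ ≤ max R₀ 0 := le_max_left _ _
    linarith
  obtain ⟨N₀, hN₀⟩ := eventually_atTop.1 (hshadow.and hnear)
  -- one Krylov–Bogoliubov law per large level, carried by the shadow
  obtain ⟨Λ⟩ := (GeneralizedLimit.nonempty_holds : Nonempty GeneralizedLimit)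
  have key : ∀ i : ℕ, ∃ μ : Measure H3, IsProbabilityMeasure μ ∧ μ (Ks (N₀ + i))ᶜ = 0 ∧
      IsInvariant ν f (N₀ + i) μ := by
    intro i
    obtain ⟨⟨hne, hcl, hlev, hpath⟩, hnearN⟩ := hN₀ (N₀ + i) (Nat.le_add_right _ _)
    obtain ⟨a, ha⟩ := hne
    obtain ⟨U, hUc, -, hUK, hU⟩ := hpath a ha
    obtain ⟨μ, hμ, hinv⟩ := KrylovBogoliubovTested.stub_krylovBogoliubov ν f (N₀ + i) R U hfs hUc
      (fun t ht => hlev _ (hUK t ht)) (fun t ht => hnearN _ (hUK t ht)) hU Λ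
    exact ⟨μ, hμ.1, hμ.measure_compl_eq_zero hcl le_rfl hUK, hinv⟩
  choose μ hp hnull hinv using key
  have hmem : ∀ i, ∀ᵐ u ∂(μ i), u ∈ Ks (N₀ + i) := fun i => by
    rw [ae_iff]
    exact hnull i
  have hl : ∀ i, ∀ᵐ u ∂(μ i), IsLevel (N₀ + i) u := fun i =>
    (hmem i).mono fun u hu => (hN₀ (N₀ + i) (Nat.le_add_right _ _)).1.2.2.1 u hu
  have hb : ∀ i, ∀ᵐ u ∂(μ i), ‖u‖ ≤ R := fun i =>
    (hmem i).mono fun u hu => (hN₀ (N₀ + i) (Nat.le_add_right _ _)).2 u hu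
  have hs : ∀ i (d : ℕ), IsPolyStationary ν f (N₀ + i) d (μ i) := fun i d =>
    (isInvariant_iff_forall.1 (hinv i)) d
  -- the `N`-uniform enstrophy budget and the Rellich–Prokhorov extraction
  have hM : ∀ i, Torus.ensembleEnstrophy (μ i) ≤
      ((Real.sqrt (∫ x, ‖f x‖ ^ 2) * R / ν).toNNReal : ℝ≥0∞) := fun i => by
    haveI := hp i
    exact UpperSemicontinuity.ensembleEnstrophy_le_energyRowBudget hν hf (hl i) (hb i) (hs i 3)
  obtain ⟨φ, hφ, μlim, hplim, hblim, hBC, hLSC, -, -⟩ :=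
    MomentParityResolvedDissipation.TightExtraction.stub_tightExtraction R _ μ hp hb hM
  haveI := hplim
  have hN : Tendsto (fun i => N₀ + φ i) atTop atTop :=
    tendsto_atTop_mono (fun i => Nat.le_add_left _ _) hφ.tendsto_atTop
  -- the limit is a stationary statistical solution …
  have hSSS : Torus.IsStationaryStatisticalSolution ν f μlim :=
    MomentParityResolvedDissipation.LimitSSS.stub_limitIsStationarySolution ν f R hν hf
      (fun i => N₀ + φ i) (fun i => μ (φ i)) (fun i => hp (φ i)) (fun i => hl (φ i))
      (fun i => hb (φ i)) (fun i d => hs (φ i) d) hN μlim hplim hblim hBC hLSC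
  -- … carried by `K`
  have hKnull : μlim Kᶜ = 0 := by
    refine UpperSemicontinuity.measure_compl_eq_zero_of_lsc hKc.isClosed hLSC fun η hη => ?_
    obtain ⟨N₁, hN₁⟩ := eventually_atTop.1 (hacc η hη)
    refine eventually_atTop.2 ⟨N₁, fun i hi => ?_⟩
    have hle : N₁ ≤ N₀ + φ i := hi.trans ((hφ.id_le i).trans (Nat.le_add_left _ _))
    refine measure_mono_null (fun u hu => ?_) (hnull (φ i))
    intro hu'
    obtain ⟨b, hbK, hub⟩ := hN₁ _ hle u hu'
    exact hu (thickening_subset_cthickening η K (mem_thickening_iff.2 ⟨b, hbK, by rwa [dist_eq_norm]⟩))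
  -- the window
  obtain ⟨hE, hD⟩ := hwin μlim hplim hKnull fun Φ => hSSS.generator Φ
  exact ⟨μlim, hSSS, integrable_norm_pow_of_ae_le hblim 2, hKnull, hE, hD⟩

/-- **The load-bearing stub of the line implies the ensemble zeroth law for some force.** If
`stub_indexedLoudShadows` holds (its registered statement, verbatim, is the hypothesis), then for its force
`f` — smooth, divergence free, mean zero — `EnsembleZerothLawAt f` holds: along its `ν_j → 0⁺` there are
stationary statistical solutions of NS at `(ν_j, f)` with finite second moments, energies `≤ E` and
dissipations `≥ ε > 0` (the loud laws carried by the carriers `K_j`, `exists_loudSSS_of_shadows`). The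
conclusion is verbatim the body of route Ensemble's open crux `EnsembleZerothLawSomeForce`
(stmt-AnomalousDissipation-0214). [folklore] -/
theorem ensembleZerothLaw_of_indexedLoudShadows
    (h : ∃ f : T3 → R3, Torus.IsSmooth f ∧ Torus.IsDivFree f ∧ Torus.HasZeroMean f ∧
      ∃ (ν : ℕ → ℝ) (E ε : ℝ), (∀ j, 0 < ν j) ∧ Tendsto ν atTop (𝓝 0) ∧ 0 < ε ∧
      ∀ j : ℕ, ∃ (K : Set H3) (Ks : ℕ → Set H3), IsCompact K ∧
        (∀ μ : Measure H3, IsProbabilityMeasure μ → μ Kᶜ = 0 →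
          (∀ Φ : Torus.CylindricalTest (Fin 3),
            Integrable (fun u => Torus.nsGeneratorPairing (ν j) f u (Φ.grad u)) μ ∧
              ∫ u, Torus.nsGeneratorPairing (ν j) f u (Φ.grad u) ∂μ = 0) →
          Torus.ensembleEnergy μ < E ∧ ε < Torus.ensembleDissipation (ν j) μ) ∧
        (∀ᶠ N in atTop, (Ks N).Nonempty ∧ IsClosed (Ks N) ∧ (∀ a ∈ Ks N, IsLevel N a) ∧
          ∀ a ∈ Ks N, ∃ U : ℝ → H3, ContinuousOn U (Ici 0) ∧ U 0 = a ∧ (∀ t, 0 ≤ t → U t ∈ Ks N) ∧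
            ∀ b : T3 → R3, IsBandTest N b → ∀ s t : ℝ, 0 ≤ s → s ≤ t →
              Torus.pairing (U t).1 b - Torus.pairing (U s).1 b =
                ∫ τ in s..t, Torus.nsGeneratorPairing (ν j) f (U τ) b) ∧
        (∀ η : ℝ, 0 < η → ∀ᶠ N in atTop, ∀ a ∈ Ks N, ∃ b ∈ K, ‖a - b‖ < η)) :
    ∃ f : T3 → R3, Torus.IsSmooth f ∧ Torus.IsDivFree f ∧ Torus.HasZeroMean f ∧
      EnsembleZerothLawAt f := by
  obtain ⟨f, hfs, hfd, hfz, ν, E, ε, hν, hν0, hε, hj⟩ := h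
  have key : ∀ j, ∃ μ : Measure H3, Torus.IsStationaryStatisticalSolution (ν j) f μ ∧
      Integrable (fun u : H3 => ‖u‖ ^ 2) μ ∧ Torus.ensembleEnergy μ ≤ E ∧
      ε ≤ Torus.ensembleDissipation (ν j) μ := by
    intro j
    obtain ⟨K, Ks, hKc, hwin, hshadow, hacc⟩ := hj j
    obtain ⟨μ, hS, h2, -, hE, hD⟩ := exists_loudSSS_of_shadows (hν j) hfs hKc hwin hshadow hacc
    exact ⟨μ, hS, h2, hE.le, hD.le⟩
  choose μ hS h2 hE hD using key
  exact ⟨f, hfs, hfd, hfz, ν, μ, hν, hν0, hS, h2, ⟨E, hE⟩, ε, hε, hD⟩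


/-! ## Per-viscosity inhabitation: at FIXED `ν` the datum of the stub exists (laminar Kolmogorov Dirac) -/

/-- A probability law on `H` carried by a singleton is the Dirac mass. [folklore] -/
theorem eq_dirac_of_measure_compl_singleton {μ : Measure H3} [IsProbabilityMeasure μ] {x : H3}
    (h : μ {x}ᶜ = 0) : μ = Measure.dirac x := by
  haveI : MeasurableSingletonClass H3 := OpensMeasurableSpace.toMeasurableSingletonClass
  ext s hs
  rw [Measure.dirac_apply' _ hs]
  by_cases hx : x ∈ s
  · rw [indicator_of_mem hx, Pi.one_apply]
    refine le_antisymm prob_le_one ?_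
    have hsub : sᶜ ⊆ ({x} : Set H3)ᶜ := compl_subset_compl.2 (singleton_subset_iff.2 hx)
    have hsc : μ sᶜ = 0 := measure_mono_null hsub h
    have h1 : μ univ ≤ μ s + μ sᶜ := by
      rw [← union_compl_self s]
      exact measure_union_le _ _
    rwa [measure_univ, hsc, add_zero] at h1
  · rw [indicator_of_notMem hx]
    have hsub : s ⊆ ({x} : Set H3)ᶜ := subset_compl_singleton_iff.2 hx
    exact measure_mono_null hsub h

/-- **Per-viscosity inhabitation of the stub's datum (calibration).** At every FIXED viscosity `ν > 0`, for
the Kolmogorov force `K_1 = cos(2πx₁)e₀` (`kolField 1`), the per-`j` structure posited by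
`stub_indexedLoudShadows` is inhabited with a `ν`-DEPENDENT window: the laminar state `u_ν = K_a`,
`a = (4π²ν)⁻¹`, gives the compact carrier `K = {u_ν}` — every probability law carried by it is `δ_{u_ν}`
(`eq_dirac_of_measure_compl_singleton`), of energy `a²/2 < a²/2 + 1` and dissipation `2π²νa² > π²νa²` — and
the shadows `Ks N = {u_ν}` (level `1`, closed, the constant path solves the tested Galerkin equations since
`u_ν` is an exact steady state at every level, `nsGeneratorPairing_kolField`), trivially accumulating on `K`.
Hence, exactly as for the crux itself (`Negative.gilFixedViscosity_holds`), the `j`-UNIFORMITY of the window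
`(E, ε)` along `ν_j → 0` is the entire content of the stub. [folklore] -/
theorem shadowDatum_fixedViscosity {ν : ℝ} (hν : 0 < ν) :
    ∃ E ε : ℝ, 0 < ε ∧ ∃ (K : Set H3) (Ks : ℕ → Set H3), IsCompact K ∧
      (∀ μ : Measure H3, IsProbabilityMeasure μ → μ Kᶜ = 0 →
        (∀ Φ : Torus.CylindricalTest (Fin 3),
          Integrable (fun u => Torus.nsGeneratorPairing ν (kolField 1) u (Φ.grad u)) μ ∧
            ∫ u, Torus.nsGeneratorPairing ν (kolField 1) u (Φ.grad u) ∂μ = 0) →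
        Torus.ensembleEnergy μ < E ∧ ε < Torus.ensembleDissipation ν μ) ∧
      (∀ᶠ N in atTop, (Ks N).Nonempty ∧ IsClosed (Ks N) ∧ (∀ a ∈ Ks N, IsLevel N a) ∧
        ∀ a ∈ Ks N, ∃ U : ℝ → H3, ContinuousOn U (Ici 0) ∧ U 0 = a ∧ (∀ t, 0 ≤ t → U t ∈ Ks N) ∧
          ∀ b : T3 → R3, IsBandTest N b → ∀ s t : ℝ, 0 ≤ s → s ≤ t →
            Torus.pairing (U t).1 b - Torus.pairing (U s).1 b =
              ∫ τ in s..t, Torus.nsGeneratorPairing ν (kolField 1) (U τ) b) ∧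
      (∀ η : ℝ, 0 < η → ∀ᶠ N in atTop, ∀ a ∈ Ks N, ∃ b ∈ K, ‖a - b‖ < η) := by
  set a : ℝ := (4 * Real.pi ^ 2 * ν)⁻¹ with ha
  have ha0 : 0 < a := by positivity
  have hforce : kolField 1 = kolField (4 * Real.pi ^ 2 * ν * a) := by
    rw [ha, mul_inv_cancel₀ (by positivity)]
  set x : H3 := kolState a with hx
  -- the generator vanishes at the laminar state against every smooth test field
  have hgen : ∀ {w : T3 → R3}, Torus.IsSmooth w → Torus.nsGeneratorPairing ν (kolField 1) x w = 0 :=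
    fun hw => by rw [hforce]; exact nsGeneratorPairing_kolField (coe_kolState_ae a) hw
  refine ⟨a ^ 2 / 2 + 1, ν * (Real.pi ^ 2 * a ^ 2), by positivity, {x}, fun _ => {x},
    isCompact_singleton, ?_, ?_, ?_⟩
  · -- the window: the only law carried by `{x}` is `δ_x`
    intro μ hμ hnull _
    have hμx : μ = Measure.dirac x := eq_dirac_of_measure_compl_singleton hnull
    subst hμx
    rw [hx, ensembleEnergy_dirac_kolState, ensembleDissipation_dirac_kolState]
    constructor
    · linarith
    · have h1 : 0 < ν * (Real.pi ^ 2 * a ^ 2) := by positivity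
      nlinarith
  · -- the shadows: the constant path at the exact steady state
    filter_upwards [eventually_ge_atTop 1] with N hN
    refine ⟨singleton_nonempty x, isClosed_singleton, fun b hb => ?_, fun b hb => ?_⟩
    · rw [mem_singleton_iff.1 hb, hx]
      exact isLevel_kolState a hN
    · refine ⟨fun _ => x, continuousOn_const, (mem_singleton_iff.1 hb).symm,
        fun t _ => mem_singleton x, fun c hc s t _ _ => ?_⟩
      rw [sub_self]
      have h0 : (fun _ : ℝ => Torus.nsGeneratorPairing ν (kolField 1) x c) = fun _ => (0 : ℝ) :=
        funext fun _ => hgen hc.1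
      rw [h0, intervalIntegral.integral_zero]
  · -- accumulation (trivial)
    intro η hη
    exact Eventually.of_forall fun N b hb => ⟨x, mem_singleton x, by
      rw [mem_singleton_iff.1 hb, sub_self, norm_zero]; exact hη⟩


/-! ## The registered tools sub-stub (conjunction of the two results above, for the `--supports` gate) -/

/-- **Registered tools stub `stub_conleyShadowsTools`** of the line `conley-continuation-loud-saddles`
(`ledger workitem stub-add stmt-AnomalousDissipation-14283 --name stub_conleyShadowsTools`): the conjunction of
`ensembleZerothLaw_of_indexedLoudShadows` (the load-bearing stub implies the ensemble zeroth law for some force)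
and `shadowDatum_fixedViscosity` (its datum is inhabited at every fixed viscosity). [folklore] -/
theorem stub_conleyShadowsTools : ((∃ f : T3 → R3, Torus.IsSmooth f ∧ Torus.IsDivFree f ∧ Torus.HasZeroMean f ∧ ∃ (ν : ℕ → ℝ) (E ε : ℝ), (∀ j, 0 < ν j) ∧ Tendsto ν atTop (𝓝 0) ∧ 0 < ε ∧ ∀ j : ℕ, ∃ (K : Set H3) (Ks : ℕ → Set H3), IsCompact K ∧ (∀ μ : Measure H3, IsProbabilityMeasure μ → μ Kᶜ = 0 → (∀ Φ : Torus.CylindricalTest (Fin 3), Integrable (fun u => Torus.nsGeneratorPairing (ν j) f u (Φ.grad u)) μ ∧ ∫ u, Torus.nsGeneratorPairing (ν j) f u (Φ.grad u) ∂μ = 0) → Torus.ensembleEnergy μ < E ∧ ε < Torus.ensembleDissipation (ν j) μ) ∧ (∀ᶠ N in atTop, (Ks N).Nonempty ∧ IsClosed (Ks N) ∧ (∀ a ∈ Ks N, IsLevel N a) ∧ ∀ a ∈ Ks N, ∃ U : ℝ → H3, ContinuousOn U (Ici 0) ∧ U 0 = a ∧ (∀ t, 0 ≤ t → U t ∈ Ks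 N) ∧ ∀ b : T3 → R3, IsBandTest N b → ∀ s t : ℝ, 0 ≤ s → s ≤ t → Torus.pairing (U t).1 b - Torus.pairing (U s).1 b = ∫ τ in s..t, Torus.nsGeneratorPairing (ν j) f (U τ) b) ∧ (∀ η : ℝ, 0 < η → ∀ᶠ N in atTop, ∀ a ∈ Ks N, ∃ b ∈ K, ‖a - b‖ < η)) → ∃ f : T3 → R3, Torus.IsSmooth f ∧ Torus.IsDivFree f ∧ Torus.HasZeroMean f ∧ EnsembleZerothLawAt f) ∧ (∀ ν : ℝ, 0 < ν → ∃ E ε : ℝ, 0 < ε ∧ ∃ (K : Set H3) (Ks : ℕ → Set H3), IsCompact K ∧ (∀ μ : Measure H3, IsProbabilityMeasure μ → μ Kᶜ = 0 → (∀ Φ : Torus.CylindricalTest (Fin 3), Integrable (fun u => Torus.nsGeneratorPairing ν (kolField 1) u (Φ.grad u)) μ ∧ ∫ u, Torus.nsGeneratorPairing ν (kolField 1) u (Φ.grad u) ∂μ = 0) → Torus.ensembleEnergy μ < E ∧ ε < Torus.ensembleDissipation ν μ) ∧ (∀ᶠ N in atTop, (Ks N).Nonempty ∧ IsClosed (Ks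 N) ∧ (∀ a ∈ Ks N, IsLevel N a) ∧ ∀ a ∈ Ks N, ∃ U : ℝ → H3, ContinuousOn U (Ici 0) ∧ U 0 = a ∧ (∀ t, 0 ≤ t → U t ∈ Ks N) ∧ ∀ b : T3 → R3, IsBandTest N b → ∀ s t : ℝ, 0 ≤ s → s ≤ t → Torus.pairing (U t).1 b - Torus.pairing (U s).1 b = ∫ τ in s..t, Torus.nsGeneratorPairing ν (kolField 1) (U τ) b) ∧ (∀ η : ℝ, 0 < η → ∀ᶠ N in atTop, ∀ a ∈ Ks N, ∃ b ∈ K, ‖a - b‖ < η)) :=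
  ⟨ensembleZerothLaw_of_indexedLoudShadows, fun _ hν => shadowDatum_fixedViscosity hν⟩

end Summit.AnomalousDissipation.AnomalousDissipation.Theorems.GalerkinInvariantLoud.ConleyShadows

end
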